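import Summits.QuantumFields.YangMills.Theorems.BalabanUVNodesN08Thm2AtRecordLevelZero
import Summits.QuantumFields.YangMills.Theorems.BalabanUVNodesN08RelativeTo5
import Summits.QuantumFields.Balaban3D.Carriers.Tower
import Summits.QuantumFields.Balaban3D.Proofs.EndTheorem

/-!
# BalabanUVNodes ∕ N08 — [Balaban1985UV3] Thm 2 at the runs of record: THE LEVEL-0 BACKGROUND SEAM between the d = 3 lane's run objects
# (ruling R-K0: `U₀ := id`) and the slot of record's binders (`U₀ :=` [7]'s minimiser-or-junk), its dissolution for a class radius `εbg > 2`, and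
# THE BRIDGE it opens: lane towers PINNED TO THE RECORD'S BINDERS extend them, so leaf systems on them ARE the record's per-run data

Track A, DAG node N08 = T. Bałaban, CMP **102** (1985) 255–275 [Balaban1985UV3], (5) p. 256 L35–36 «U_k(U) is the minimal configuration constructed in
[7]», (1) p. 256 (no `U₀` in print), Thm 2 p. 272, Thm 1 p. 257; [7] = [Balaban1985Variational] Thm 1 p. 279, class (2) p. 278 «|U(∂p) − 1| < ε»;
[Balaban1985Averaging] (19) p. 21 (`|· − 1|` = operator norm).  Cell `pub-ymgap`, width seat `pub-ymgap-dag-n08-w1`, W-SEAT-START-LIST §n08 item 1 (file 2);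
`--supports` K1⁷ `StabilityBAtRecordR13SepCoPH` (helper).  Companion of `BalabanUVNodesN08Thm2AtRecordLevelZero` (§1 there: at level 0 the record's
`U₀(V) = V` on [7]'s class, `= 1` off it).

§2 THE SEAM (kernel).  The Thm-2 conjunct of the slot of record is «per-run data» (n08-e): tower objects `W` with `W.toRunObjects = R₀ c S`, `R₀` the
record's binders.  EVERY run-object family whose level-0 background is the identity — the d = 3 lane's `Balaban3D.Carriers.run3 I` (`RunInput.UkAll 0 =
id`), hence every `TowerInput.towerWith D slot` and the lane's towers built on them — can equal the record's binders `runObjects₀A N 𝔞 𝔗 (Backgrounds.ofAvg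
N L 𝔞) c S` ONLY IF [7]'s level-0 class `PlaqSmall (εbg·η₀²)` is ALL of `GaugeField` (`class_trivial_of_eq_of_uk_zero_id`, `…_of_run3_eq`,
`…_of_towerWith_eq`).  So with a proper class (some configuration outside it) NO lane tower re-bases to the slot of record as it stands — a second
located seam beside n08-a's E6′ (averaging) seam, this one in the BACKGROUND binder at `k = 0` only.

§1∕§3 ITS DISSOLUTION (kernel).  On `SU(N)` the tree's `|· − 1|` is the operator-norm distance, so `|g − 1| ≤ 2` (`dist1_le_two`); for `εbg > 2` the level-0
class IS everything (`plaqSmall_of_two_lt`), the record's `U₀` IS the identity (`uk3_zero_eq_self_of_two_lt`, `ukA_…`), the lane's `hU0` holds at the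
record's binders (`uk_zero_eq_self_of_two_lt`) and `Balaban3D.Proofs.Step0Tower.step0_pin` applies verbatim (`step0_of_two_lt`).  (At levels `k ≥ 1` the
class radius is `εbg·L^{−2k} ≤ εbg/9`, so `εbg > 2` trivialises level 0 only; the alternative repair is definitional — level 0 of the record's `Backgrounds`
— and belongs to the node00-def ∕ `B10RunsOfRecord` lineage; not made here.)

§4 THE BRIDGE (kernel).  For `εbg > 2` the lane's stage-1 tower objects over inputs `D S` PINNED TO THE RECORD'S BINDERS (`ε₁ :=` print's (7), `reg :=`
[7]'s classes, `U_k :=` print's minimiser-or-junk `UkA … (k+1)` along the inputs' own averaging `fun S => (D S).av`, `Σ_{j<K}E^{(j)} = c.E S`; version of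
(2) := the lane's selected transport, R-RN) EXTEND THOSE BINDERS ON THE NOSE (`towerWith_toRunObjects_eq`; the structure equation field by field, `U₀` by
§1).  Hence a leaf system on the lane's pinned tower `tower3 (D S)` IS a per-run datum of the record (`repr41_47G_of_leafSystem_tower3`, via n08-e's
`repr41_47G_of_leafSystem`); per-run leaf systems give the record's Thm-2 conjunct at that averaging (`thm2Printed_of_leafSystems_tower3`); the lane's
CONCRETE LEAVES (`EndTheorem.UsesConsts` + `UVStability3D.AnalyticLeaves`, by `leafSystem_of_concrete ∘ carrierEqs_pin`) give the datum
(`repr41_47G_of_analyticLeaves_tower3`), uniform ones the printed pair `PrintedUV3G` at that averaging (`printedUV3G_of_analyticLeaves_tower3`) and, along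
an ADMISSIBLE averaging, the primed slot `Node00.PrintedUV3V'` (`printedUV3V'_of_analyticLeaves_tower3`; with `(D S).av := avOfPrint N S` the unprimed
`PrintedUV3V` by ∃-introduction on the version).  The hypotheses ARE the lane's analytic leaves of Sects. A∕C∕D over towers at the record's binders = N08's
object gap; nothing of them is asserted — a LOCATED socket in the sense of cell rule A6 (the tree inhabits `AnalyticLeaves` only for trivial runs;
the binder-pinning hypotheses on `D` and `εbg > 2` are plain data choices).

HONEST FRAMING: count-neutral helper; N08 NOT discharged; nothing of [B10] asserted; `PrintedUV3V` ∕ `PrintedUV3V'` NOT proved; one finite 𝕋⁴ programme at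
fixed ε, Bałaban AS PRINTED; nothing continuum ∕ ℝ⁴ ∕ OS ∕ mass gap ∕ Clay.  Theorems only, no `sorry`, standard axioms.
-/

noncomputable section

namespace Summit.QuantumFields.YangMills.BalabanUVNodes.N08Thm2AtRecordSeamK0

open Literature.MathematicalPhysics.QuantumFieldTheory.Balaban1983to89
open Literature.MathematicalPhysics.QuantumFieldTheory.Balaban1983to89.Node00 (SU TFamily₃)
open Literature.MathematicalPhysics.QuantumFieldTheory.Balaban1983to89.B10RunsOfRecord
open Literature.MathematicalPhysics.QuantumFieldTheory.Balaban1985CMP102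
open Literature.MathematicalPhysics.QuantumFieldTheory.Balaban1985CMP102.Setting
open Literature.MathematicalPhysics.QuantumFieldTheory.Balaban1985CMP102.Theorems (Family)
open Literature.MathematicalPhysics.QuantumLattice (fundamentalRep fundamentalRep_mem_unitaryGroup)
open Summit.QuantumFields.Balaban3D
open Summit.QuantumFields.YangMills.BalabanUVNodes.N08Thm2AtRecordLevelZero
open scoped Matrix.Norms.L2Operator

/-! ## §1 On `SU(N)`: `|g − 1| ≤ 2`, so a class of radius `> 2` is everything and the record's `U₀` is the identity -/
section SUN

variable (N : ℕ) [NeZero N]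

/-- **`|g − 1| ≤ 2` on `SU(N)`** — the tree's `dist1` is `‖g − 1‖` in the operator norm ([Balaban1985Averaging] (19)), and `‖g‖ = ‖1‖ = 1` for unitary
matrices. [cite: Balaban1985Averaging, (19) p.21] -/
theorem dist1_le_two (g : SU N) : dist1 g ≤ 2 := by
  show UnitaryModel.opDist1 (fundamentalRep (Fin N) g) ≤ 2
  unfold UnitaryModel.opDist1
  have h1 : ‖(fundamentalRep (Fin N) g : Matrix (Fin N) (Fin N) ℂ)‖ = 1 :=
    UnitaryModel.norm_of_mem_unitaryGroup (fundamentalRep_mem_unitaryGroup g)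
  have h2 : ‖(1 : Matrix (Fin N) (Fin N) ℂ)‖ = 1 := UnitaryModel.norm_of_mem_unitaryGroup (Submonoid.one_mem _)
  calc ‖fundamentalRep (Fin N) g - 1‖ ≤ ‖fundamentalRep (Fin N) g‖ + ‖(1 : Matrix (Fin N) (Fin N) ℂ)‖ := norm_sub_le _ _
    _ = 2 := by rw [h1, h2]; norm_num

variable {L : ℕ} (S : Scales L)

/-- **A class of radius `> 2` is all of `GaugeField`** (every plaquette variable is within `2` of `1`). [cite: Balaban1985Variational, (2) p.278 (bookkeeping)] -/
theorem plaqSmall_of_two_lt {j : ℕ} {δ : ℝ} (hδ : 2 < δ) (V : GaugeField S.P j (SU N)) : PlaqSmall δ V :=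
  fun _ => lt_of_le_of_lt (dist1_le_two N _) hδ

/-- … in particular [7]'s LEVEL-0 class for `εbg > 2` (`η₀ = 1`). [cite: Balaban1985Variational, (2) p.278 (at k = 0)] -/
theorem plaqSmall_level_zero_of_two_lt {εbg : ℝ} (hε : 2 < εbg) (V : GaugeField S.P 0 (SU N)) : PlaqSmall (εbg * S.eta 0 ^ 2) V :=
  (plaqSmall_eta_zero_iff N S εbg V).2 (plaqSmall_of_two_lt N S hε V)

/-- **For `εbg > 2` print's own level-0 background of record IS the identity**: `Uk3 N S 0 εbg V = V` for every `V`. [cite: Balaban1985UV3, (5) p.256 L35–36 (at k = 0)] -/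
theorem uk3_zero_eq_self_of_two_lt {εbg : ℝ} (hε : 2 < εbg) (V : GaugeField S.P 0 (SU N)) : Uk3 N S 0 εbg V = V :=
  uk3_zero_of_plaqSmall N S εbg V (plaqSmall_level_zero_of_two_lt N S hε V)

/-- The same along any averaging `𝔞` (`UkA`). [cite: Balaban1985UV3, (5) p.256 L35–36 (at k = 0)] -/
theorem ukA_zero_eq_self_of_two_lt (𝔞 : ∀ S : Scales L, ∀ j, Averaging S.P j (SU N)) {εbg : ℝ} (hε : 2 < εbg)
    (V : GaugeField S.P 0 (SU N)) : UkA N 𝔞 S 0 εbg V = V :=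
  ukA_zero_of_plaqSmall N 𝔞 S εbg V (plaqSmall_level_zero_of_two_lt N S hε V)

end SUN

/-! ## §2 THE SEAM: run objects with `U₀ = id` equal the record's binders only if [7]'s level-0 class is everything -/
section Seam

variable {N : ℕ} [NeZero N] {L : ℕ} {𝔞 : ∀ S : Scales L, ∀ j, Averaging S.P j (SU N)}
  {𝔗 : ∀ S : Scales L, ∀ j, RTOpI S.P j (SU N) (𝔞 S j)} {c : Consts L} {S : Scales L}

/-- **THE LEVEL-0 BACKGROUND SEAM, general form**: if run objects `R` whose level-0 background is the identity EQUAL the record's binders, then the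
record's `U₀` is the identity, i.e. (for `εbg > 0`) every configuration lies in [7]'s level-0 class. [cite: Balaban1985UV3, (5) p.256 L35–36; Balaban1985Variational, (2) p.278 (at k = 0)] -/
theorem class_trivial_of_eq_of_uk_zero_id (R : RunObjects S (SU N)) (hR : R = runObjects₀A N 𝔞 𝔗 (Backgrounds.ofAvg N L 𝔞) c S)
    (hU0 : ∀ V : GaugeField S.P 0 (SU N), R.Uk 0 V = V) (hε : 0 < c.εbg) (V : GaugeField S.P 0 (SU N)) :
    PlaqSmall (c.εbg * S.eta 0 ^ 2) V := by
  by_contra hV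
  have h1 : R.Uk 0 V = UkA N 𝔞 S 0 c.εbg V := congrFun (congrFun (congrArg RunObjects.Uk hR) 0) V
  exact ukA_zero_ne_self N 𝔞 S c.εbg V hε hV (h1 ▸ hU0 V)

/-- **THE SEAM for the d = 3 lane's run objects `run3 I`** (`RunInput.UkAll 0 = id`, ruling R-K0): `run3 I` equals the record's binders only if the
level-0 class is everything. [cite: Balaban1985UV3, (5) p.256 L35–36 (at k = 0; the lane ↔ record contrast)] -/
theorem class_trivial_of_run3_eq (I : Carriers.RunInput S (SU N)) (hR : Carriers.run3 I = runObjects₀A N 𝔞 𝔗 (Backgrounds.ofAvg N L 𝔞) c S)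
    (hε : 0 < c.εbg) (V : GaugeField S.P 0 (SU N)) : PlaqSmall (c.εbg * S.eta 0 ^ 2) V :=
  class_trivial_of_eq_of_uk_zero_id (Carriers.run3 I) hR (fun U => I.UkAll_zero U) hε V

/-- **THE SEAM for the lane's tower objects**: `(D.towerWith slot).toRunObjects` — the run objects under the lane's towers `tower3 D = (D.towerWith _).pin`
— equal the record's binders only if the level-0 class is everything; with a configuration outside the class NO such tower supplies the record's
per-run data as the binders stand. [cite: Balaban1985UV3, (38)–(43) p.266 + (5) p.256 L35–36 (at k = 0)] -/
theorem class_trivial_of_towerWith_eq (D : Carriers.TowerInput S (SU N)) (slot : ℕ → Prop)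
    (hW : (D.towerWith slot).toRunObjects = runObjects₀A N 𝔞 𝔗 (Backgrounds.ofAvg N L 𝔞) c S) (hε : 0 < c.εbg)
    (V : GaugeField S.P 0 (SU N)) : PlaqSmall (c.εbg * S.eta 0 ^ 2) V :=
  class_trivial_of_eq_of_uk_zero_id _ hW (fun U => D.ukAll_eq slot 0 U) hε V

/-- Contrapositive, the form a supplier reads: a configuration OUTSIDE [7]'s level-0 class (proper class, `εbg > 0`) forbids `towerWith`-extension of
the record's binders. [cite: Balaban1985UV3, (5) p.256 L35–36 (at k = 0)] -/
theorem towerWith_ne_of_not_plaqSmall (D : Carriers.TowerInput S (SU N)) (slot : ℕ → Prop) (hε : 0 < c.εbg)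
    {V : GaugeField S.P 0 (SU N)} (hV : ¬ PlaqSmall (c.εbg * S.eta 0 ^ 2) V) :
    (D.towerWith slot).toRunObjects ≠ runObjects₀A N 𝔞 𝔗 (Backgrounds.ofAvg N L 𝔞) c S :=
  fun hW => hV (class_trivial_of_towerWith_eq D slot hW hε V)

end Seam

/-! ## §3 THE DISSOLUTION for `εbg > 2`: the lane's `hU0` holds at the record's binders, `Step0Printed` by the lane's theorem, window trivial -/
section Dissolution

variable {N : ℕ} [NeZero N] {L : ℕ} {𝔞 : ∀ S : Scales L, ∀ j, Averaging S.P j (SU N)}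
  {𝔗 : ∀ S : Scales L, ∀ j, RTOpI S.P j (SU N) (𝔞 S j)} {c : Consts L} {S : Scales L} {W : SectB.TowerObjects S (SU N)}

/-- **For `εbg > 2` the d = 3 lane's hypothesis `hU0 : ∀ V, W.Uk 0 V = V` HOLDS for every tower objects extending the record's binders.**
[cite: Balaban1985UV3, (5) p.256 L35–36 (at k = 0)] -/
theorem uk_zero_eq_self_of_two_lt (hW : W.toRunObjects = runObjects₀A N 𝔞 𝔗 (Backgrounds.ofAvg N L 𝔞) c S) (hε : 2 < c.εbg)
    (V : GaugeField S.P 0 (SU N)) : W.Uk 0 V = V := by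
  rw [uk_eq_ukA hW 0 V]
  exact ukA_zero_eq_self_of_two_lt N S 𝔞 hε V

/-- **`LeafSystem.step0` at the record's binders for `εbg > 2`, BY THE LANE'S THEOREM** (`Balaban3D.Proofs.Step0Tower.step0_pin` with `hU0` supplied):
print's k = 0 data (`LF 0 V F = exp (F triv)`, `Pint 0 ≡ 0`) give (41)₀ ∧ (47)₀. [cite: Balaban1985UV3, (1) p.256 + (41) p.266 + (47) p.267] -/
theorem step0_of_two_lt (hW : W.toRunObjects = runObjects₀A N 𝔞 𝔗 (Backgrounds.ofAvg N L 𝔞) c S) (hε : 2 < c.εbg)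
    (hLF : ∀ (V : GaugeField S.P 0 (SU N)) (F : W.Hist 0 → ℝ), W.LF 0 V F = Real.exp (F (W.triv 0)))
    (hP0 : ∀ (h : W.Hist 0) (V : GaugeField S.P 0 (SU N)), W.Pint 0 h V = 0) : B10.Step0Printed W.pin.toTowerRun :=
  Proofs.Step0Tower.step0_pin W hLF (uk_zero_eq_self_of_two_lt hW hε) hP0

/-- … and the companion file's window condition holds trivially for `εbg > 2` (so its `step0_of_window` applies with the weaker `LF` hypothesis
`exp (F triv) ≤ LF 0 V F`). [cite: Balaban1985UV3, (4) p.256 + (47) p.267 (at k = 0)] -/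
theorem step0_of_two_lt' (hW : W.toRunObjects = runObjects₀A N 𝔞 𝔗 (Backgrounds.ofAvg N L 𝔞) c S) (hε : 2 < c.εbg)
    (hP0 : ∀ (h : W.Hist 0) (V : GaugeField S.P 0 (SU N)), W.Pint 0 h V = 0)
    (hLF : ∀ (V : GaugeField S.P 0 (SU N)) (F : W.Hist 0 → ℝ), Real.exp (F (W.triv 0)) ≤ W.LF 0 V F) : B10.Step0Printed W.pin.toTowerRun :=
  step0_of_window hW hP0 hLF fun V _ => plaqSmall_level_zero_of_two_lt N S hε V

variable (N) in
/-- **At the slot of record** (`𝔞 := avOfPrint N`, `Backgrounds.ofPrint`, any version `𝔗 : TFamily₃ N L`): for `εbg > 2` the record's own `U₀` is the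
identity at every lattice approximation, and a configuration outside a proper class forbids `towerWith`-extension. [cite: Balaban1985UV3, (5) p.256 L35–36 (at k = 0)] -/
theorem ofPrint_uk_zero_eq_self_of_two_lt (c : Consts L) (hε : 2 < c.εbg) (S : Scales L) (V : GaugeField S.P 0 (SU N)) :
    ((Backgrounds.ofPrint N L c).Uk S 0 V) = V :=
  uk3_zero_eq_self_of_two_lt N S hε V

end Dissolution


/-! ## §4 THE BRIDGE for `εbg > 2`: lane tower inputs AT THE RECORD'S BINDERS extend them, so leaf systems on the lane's towers ARE the record's per-run data -/
section Bridge

variable {N : ℕ} [NeZero N] {L : ℕ}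

/-- **Field-wise equality of the spine's run objects** (the transformation field depends on the averaging field, hence `HEq`); generic bookkeeping
used by every binder equation below and in the companions. [cite: Balaban1985UV3, (1)–(6) pp.256–257 (the binders; bookkeeping)] -/
theorem runObjects_ext {S : Scales L} (R R' : RunObjects S (SU N)) (hE : R.E = R'.E) (hε : R.ε₁ = R'.ε₁) (hav : R.av = R'.av)
    (hT : HEq R.T R'.T) (hreg : R.reg = R'.reg) (hU : R.Uk = R'.Uk) (hs : R.ineq41_47 = R'.ineq41_47) : R = R' := by
  cases R; cases R'
  cases hE; cases hε; cases hav; cases hreg; cases hU; cases hs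
  cases hT
  rfl

/-- **THE SEAM DISSOLVED, POSITIVELY: for `εbg > 2` the d = 3 lane's stage-1 tower objects `towerWith` over inputs PINNED TO THE RECORD'S BINDERS
EXTEND THEM ON THE NOSE** — inputs `D S` with `ε₁ :=` print's (7) `eps1OfPrint c S`, `reg :=` [7]'s classes `bgReg3 … c.εbg`, `U_k` (`k ≥ 1`) `:=` print's
minimiser-or-junk `UkA … (k+1) c.εbg` along the inputs' own averaging family `fun S => (D S).av`, and `Σ_{j<K} E^{(j)} = c.E S` ((64)); the version of
(2) is the lane's selected Radon–Nikodym transport `run3`'s `T` (ruling R-RN), an `RTOpI` along that averaging; at `k = 0` the lane's `U₀ = id` IS the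
record's `U₀` by §1. [cite: Balaban1985UV3, (1)–(7) pp.256–257 + (38)–(43) p.266 (the binders, bookkeeping); Balaban1985Variational, Thm 1 p.279] -/
theorem towerWith_toRunObjects_eq (D : ∀ S : Scales L, Carriers.TowerInput S (SU N)) (c : Consts L) (hε : 2 < c.εbg)
    (hε₁ : ∀ (S : Scales L) k, (D S).ε₁ k = eps1OfPrint c S k) (hreg : ∀ (S : Scales L) k, (D S).reg k = bgReg3 N S k c.εbg)
    (hUk : ∀ (S : Scales L) k (V : GaugeField S.P (k + 1) (SU N)), (D S).Uk k V = UkA N (fun S => (D S).av) S (k + 1) c.εbg V)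
    (hE : ∀ S : Scales L, B10.Ek (D S).Estep S.K 0 = c.E S) (S : Scales L) :
    ((D S).towerWith fun _ => True).toRunObjects =
      runObjects₀A N (fun S => (D S).av) (fun S j => (Carriers.run3 ((D S).toRunInput fun _ => True)).T j)
        (Backgrounds.ofAvg N L fun S => (D S).av) c S := by
  have hU : ∀ (k : ℕ) (V : GaugeField S.P k (SU N)),
      (Carriers.run3 ((D S).toRunInput fun _ => True)).Uk k V = UkA N (fun S => (D S).av) S k c.εbg V := by
    intro k V
    cases k with
    | zero => exact (ukA_zero_eq_self_of_two_lt N S (fun S => (D S).av) hε V).symm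
    | succ k => exact hUk S k V
  exact runObjects_ext _ _ (hE S) (funext (hε₁ S)) rfl HEq.rfl (funext (hreg S)) (funext fun k => funext (hU k)) rfl

/-- Hence **a leaf system on the lane's pinned tower `tower3 (D S) = ((D S).towerWith _).pin` IS a per-run datum of the record at `S`** (the ∃-representation
reading `Repr41_47G` at every `k ≤ K`, n08-e's `repr41_47G_of_leafSystem`). [cite: Balaban1985UV3, Thm 2 p.272, (41) p.266, (47) p.267] -/
theorem repr41_47G_of_leafSystem_tower3 (D : ∀ S : Scales L, Carriers.TowerInput S (SU N)) (c : Consts L) (hε : 2 < c.εbg)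
    (hε₁ : ∀ (S : Scales L) k, (D S).ε₁ k = eps1OfPrint c S k) (hreg : ∀ (S : Scales L) k, (D S).reg k = bgReg3 N S k c.εbg)
    (hUk : ∀ (S : Scales L) k (V : GaugeField S.P (k + 1) (SU N)), (D S).Uk k V = UkA N (fun S => (D S).av) S (k + 1) c.εbg V)
    (hE : ∀ S : Scales L, B10.Ek (D S).Estep S.K 0 = c.E S) {S : Scales L} {C : B10Assembly.Consts}
    (LS : B10Assembly.LeafSystem C (D S).tower3.toTowerRun) (k : ℕ) (hk : k ≤ S.K) :
    Repr41_47G N (runObjects₀A N (fun S => (D S).av) (fun S j => (Carriers.run3 ((D S).toRunInput fun _ => True)).T j)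
      (Backgrounds.ofAvg N L fun S => (D S).av)) c S k :=
  Theorems.BalabanUVNodesN08RelativeTo5.repr41_47G_of_leafSystem N _ c ((D S).towerWith fun _ => True)
    (towerWith_toRunObjects_eq D c hε hε₁ hreg hUk hE S) LS k hk

/-- **THE RECORD'S Thm-2 CONJUNCT at the averaging of the inputs, FROM LEAF SYSTEMS ON THE LANE'S TOWERS PINNED TO THE RECORD'S BINDERS** (`εbg > 2`;
per-run constants `C_S` suffice). [cite: Balaban1985UV3, Thm 2 p.272] -/
theorem thm2Printed_of_leafSystems_tower3 (D : ∀ S : Scales L, Carriers.TowerInput S (SU N)) (c : Consts L) (hε : 2 < c.εbg)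
    (hε₁ : ∀ (S : Scales L) k, (D S).ε₁ k = eps1OfPrint c S k) (hreg : ∀ (S : Scales L) k, (D S).reg k = bgReg3 N S k c.εbg)
    (hUk : ∀ (S : Scales L) k (V : GaugeField S.P (k + 1) (SU N)), (D S).Uk k V = UkA N (fun S => (D S).av) S (k + 1) c.εbg V)
    (hE : ∀ S : Scales L, B10.Ek (D S).Estep S.K 0 = c.E S)
    (h : ∀ S : Family L c.eps0, ∃ C : B10Assembly.Consts, Nonempty (B10Assembly.LeafSystem C (D S.1).tower3.toTowerRun)) :
    B10.Thm2Printed (runsAtG N (runObjects₀A N (fun S => (D S).av) (fun S j => (Carriers.run3 ((D S).toRunInput fun _ => True)).T j)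
      (Backgrounds.ofAvg N L fun S => (D S).av)) c) := by
  intro S k hk
  obtain ⟨C, ⟨LS⟩⟩ := h S
  exact repr41_47G_of_leafSystem_tower3 D c hε hε₁ hreg hUk hE LS k hk

/-- **… and from the lane's CONCRETE LEAVES**: `UsesConsts C` on the stage-1 tower (the family's `M₁, b₀, p₀, κ₀`, `rcoef`; lane `EndTheorem.carrierEqs_pin`) +
`AnalyticLeaves C S` on the pinned tower (Sects. A∕C∕D as hypotheses — N08's object gap) give the leaf system (`UVStability3D.leafSystem_of_concrete`), hence
the record's per-run datum at `S`. [cite: Balaban1985UV3, Thm 2 p.272 + pp.256–274 (the leaves)] -/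
theorem repr41_47G_of_analyticLeaves_tower3 (D : ∀ S : Scales L, Carriers.TowerInput S (SU N)) (c : Consts L) (hε : 2 < c.εbg)
    (hε₁ : ∀ (S : Scales L) k, (D S).ε₁ k = eps1OfPrint c S k) (hreg : ∀ (S : Scales L) k, (D S).reg k = bgReg3 N S k c.εbg)
    (hUk : ∀ (S : Scales L) k (V : GaugeField S.P (k + 1) (SU N)), (D S).Uk k V = UkA N (fun S => (D S).av) S (k + 1) c.εbg V)
    (hE : ∀ S : Scales L, B10.Ek (D S).Estep S.K 0 = c.E S) {C : B10Assembly.Consts} (hC : Proofs.Constants.NormalisedConsts L C)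
    {S : Scales L} (hUC : Proofs.EndTheorem.UsesConsts C ((D S).towerWith fun _ => True))
    (A : Proofs.UVStability3D.AnalyticLeaves C S (D S).tower3.toTowerRun) (k : ℕ) (hk : k ≤ S.K) :
    Repr41_47G N (runObjects₀A N (fun S => (D S).av) (fun S j => (Carriers.run3 ((D S).toRunInput fun _ => True)).T j)
      (Backgrounds.ofAvg N L fun S => (D S).av)) c S k :=
  repr41_47G_of_leafSystem_tower3 D c hε hε₁ hreg hUk hE
    (Proofs.UVStability3D.leafSystem_of_concrete hC ⟨Proofs.EndTheorem.carrierEqs_pin _ hUC, A⟩) k hk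

/-- **THE PRINTED PAIR `PrintedUV3G` at the inputs' averaging FROM UNIFORM CONCRETE LEAVES on the lane's towers pinned to the record's binders** (admissible `c`
with `εbg > 2`; ONE `C` for the family — Thm 1's «O(1) independent of ε, k»; `B10RunsOfRecord.printedUV3G_of_uniformLeafSystems`).  With `(D S).av := avOfPrint N S`
this is the slot of record `PrintedUV3V N L` by ∃-introduction on the version; with an ADMISSIBLE averaging it is the primed slot (next theorem).
[cite: Balaban1985UV3, Thm 1 p.257 + Thm 2 p.272 + pp.256–274 (the leaves)] -/
theorem printedUV3G_of_analyticLeaves_tower3 (D : ∀ S : Scales L, Carriers.TowerInput S (SU N)) (c : Consts L) (hc : c.Adm) (hε : 2 < c.εbg)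
    (hε₁ : ∀ (S : Scales L) k, (D S).ε₁ k = eps1OfPrint c S k) (hreg : ∀ (S : Scales L) k, (D S).reg k = bgReg3 N S k c.εbg)
    (hUk : ∀ (S : Scales L) k (V : GaugeField S.P (k + 1) (SU N)), (D S).Uk k V = UkA N (fun S => (D S).av) S (k + 1) c.εbg V)
    (hE : ∀ S : Scales L, B10.Ek (D S).Estep S.K 0 = c.E S) {C : B10Assembly.Consts} (hC : Proofs.Constants.NormalisedConsts L C)
    (hUC : ∀ S : Family L c.eps0, Proofs.EndTheorem.UsesConsts C ((D S.1).towerWith fun _ => True))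
    (A : ∀ S : Family L c.eps0, Proofs.UVStability3D.AnalyticLeaves C S.1 (D S.1).tower3.toTowerRun) :
    PrintedUV3G N L (runObjects₀A N (fun S => (D S).av) (fun S j => (Carriers.run3 ((D S).toRunInput fun _ => True)).T j)
      (Backgrounds.ofAvg N L fun S => (D S).av)) :=
  printedUV3G_of_uniformLeafSystems N L _ ⟨c, hc, C, fun S => ⟨(D S.1).towerWith fun _ => True, towerWith_toRunObjects_eq D c hε hε₁ hreg hUk hE S.1,
    ⟨Proofs.UVStability3D.leafSystem_of_concrete hC ⟨Proofs.EndTheorem.carrierEqs_pin _ (hUC S), A S⟩⟩⟩⟩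

/-- **THE PRIMED SLOT `Node00.PrintedUV3V' N L`** (chair R451 (R-b): Thm 1-compact ∧ Thm 2 with their ∃-prefix at SOME ADMISSIBLE averaging of print's class) **FROM
UNIFORM CONCRETE LEAVES on the lane's towers pinned to the record's binders along an admissible averaging**, `εbg > 2`. [cite: Balaban1985UV3, Thm 1 p.257 + Thm 2 p.272; Balaban1985Averaging, (14)–(15) p.19] -/
theorem printedUV3V'_of_analyticLeaves_tower3 (D : ∀ S : Scales L, Carriers.TowerInput S (SU N)) (h𝔞 : Node00.AvgAdmissible₃ N fun S => (D S).av)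
    (c : Consts L) (hc : c.Adm) (hε : 2 < c.εbg)
    (hε₁ : ∀ (S : Scales L) k, (D S).ε₁ k = eps1OfPrint c S k) (hreg : ∀ (S : Scales L) k, (D S).reg k = bgReg3 N S k c.εbg)
    (hUk : ∀ (S : Scales L) k (V : GaugeField S.P (k + 1) (SU N)), (D S).Uk k V = UkA N (fun S => (D S).av) S (k + 1) c.εbg V)
    (hE : ∀ S : Scales L, B10.Ek (D S).Estep S.K 0 = c.E S) {C : B10Assembly.Consts} (hC : Proofs.Constants.NormalisedConsts L C)
    (hUC : ∀ S : Family L c.eps0, Proofs.EndTheorem.UsesConsts C ((D S.1).towerWith fun _ => True))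
    (A : ∀ S : Family L c.eps0, Proofs.UVStability3D.AnalyticLeaves C S.1 (D S.1).tower3.toTowerRun) : Node00.PrintedUV3V' N L :=
  ⟨fun S => (D S).av, h𝔞, fun S j => (Carriers.run3 ((D S).toRunInput fun _ => True)).T j,
    printedUV3G_of_analyticLeaves_tower3 D c hc hε hε₁ hreg hUk hE hC hUC A⟩

end Bridge

end Summit.QuantumFields.YangMills.BalabanUVNodes.N08Thm2AtRecordSeamK0

end
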